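import Literature.NumberTheory.GaloisRepresentations.LubinTateUnramifiedTowerCoordinates
import Literature.NumberTheory.GaloisRepresentations.LubinTateColemanTwoVariableLimitTwo
import Literature.NumberTheory.EllipticCurves.IwasawaAlgebraGroupRingLimit
import HarnessLib

/-!
# `lim←_{Tr} 𝒪_{E_m} ≅ 𝒪_F⟦X⟧` for an unramified `ℤ_p`-tower, with the Frobenius acting as multiplication by `1 + X`
# (the unramified half of the `Λ`-structure of the Coleman coordinates, end to end)

De Shalit, *Iwasawa theory of elliptic curves with complex multiplication* (1987), Ch. I §3.1 ("`Λ ≅ ℤ_p⟦S⟧` … maps `u^α` to `(1+S)^α`"),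
§3.8 (16)–(17), §3.14; Washington (1997) Thm. 7.1.  For a tower `E₀ ≤ E₁ ≤ ⋯ ⊆ F^{nr}` of finite Galois extensions with `[E_m : F] = p^m`
(`Gal(E_m/F) = ⟨φ_m⟩ ≅ ℤ/p^mℤ`, `φ_m = σ₀|_{E_m}` for one arithmetic Frobenius `σ₀`) and trace-coherent integral normal generators `θ_m`
(`exists_traceCoherent_isIntegralNormalGen`), the chain

  `lim←_{Tr} 𝒪_{E_m}` —(coordinates, `LubinTateUnramifiedTowerCoordinates`)→ compatible functions on the `Gal(E_m/F)` —(`i ↦ φ_m^i`)→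
  compatible functions on the `ℤ/p^mℤ` —(Amice `Σ_x b(x)(1+X)^x`, `IwasawaAlgebraGroupRingLimit`)→ `𝒪_F⟦X⟧`

is a bijection under which the Frobenius `x ↦ (φ_m x_m)_m` becomes multiplication by `1 + X`:

* `towerRestrict_frobPow`, `frobPow_bijective`, `pushforward_frobPow_iff` — `x ↦ φ_m^x` identifies `ℤ/p^mℤ ≅ Gal(E_m/F)` compatibly with
  `ℤ/p^{m+1} ↠ ℤ/p^m` and `Gal(E_{m+1}/F) ↠ Gal(E_m/F)`, and transports push-forward-coherence;
* ★★★ `existsUnique_amice_of_traceCoherent` / `existsUnique_traceCoherent_of_series` — **`lim←_{Tr} 𝒪_{E_m} ≅ 𝒪_F⟦X⟧`**: every trace-coherent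
  family `x` has a unique `g ∈ 𝒪_F⟦X⟧` with `g ≡ Σ_{i ∈ ℤ/p^m} a_{x_m}(φ_m^i)(1+X)^i (mod ω_m)` for all `m`, and conversely;
* ★★ `amice_frob` — **the transform of `(φ_m x_m)_m` is `(1 + X)·g`**: `lim←_{Tr} 𝒪_{E_m}` is the free `𝒪_F⟦X⟧`-module of rank one on the
  coherent normal basis, `X` acting as `φ − 1` — the `Λ(Gal(E_∞/F), 𝒪_F)`-structure of de Shalit's `Λ(𝒢, 𝒪)` in the unramified direction.

Hypotheses: `𝒪_F` is `(p)`-adically complete and `p` is not a unit of `𝒪_F` (residue characteristic `p`).  Everything PROVED (0 sorry, no named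
facts, no new definitions).

## References

* E. de Shalit, *Iwasawa theory of elliptic curves with complex multiplication* (1987), Ch. I §3.1, §3.8 (16)–(17), §3.14. [deShalit1987]
* L. C. Washington, *Introduction to Cyclotomic Fields*, 2nd ed. (1997), §7.1 Thm. 7.1. [Washington1997]
-/

noncomputable section

namespace Literature.NumberTheory.GaloisRepresentations

section UnramifiedTowerIwasawa

open GaloisRepresentations.IsNonarchimedeanLocalField LubinTate ValuativeRel Field Finset
open Literature.NumberTheory.EllipticCurves.IwasawaOmega

variable {F : Type} [Field F] [ValuativeRel F] [TopologicalSpace F] [IsNonarchimedeanLocalField F]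

attribute [local instance] ltNormUniformSpace ltNormIsUniformAddGroup rk1 nF nE fintypeResidueField

variable (p : ℕ) [hp : Fact p.Prime]
variable (E : ℕ → IntermediateField F (AlgebraicClosure F)) [∀ m, FiniteDimensional F (E m)] [∀ m, Normal F (E m)]
  [∀ m, IsGalois F (E m)] (hmono : Monotone E) (hE : ∀ m, E m ≤ maxUnramified F) (hdeg : ∀ m, Module.finrank F (E m) = p ^ m)
  {σ₀ : absoluteGaloisGroup F} (hσ₀ : IsAbsArithFrob σ₀)

/-! ### `ℤ/p^mℤ ≅ Gal(E_m/F)`, `i ↦ φ_m^i`, compatibly with the projections -/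

omit hp in
include hE hdeg hσ₀ in
/-- `φ_m^{p^m} = 1`: powers of the Frobenius of `E_m` only depend on the exponent modulo `p^m = [E_m:F]`.
[cite: SerreLocalFields1979, Ch. I §4 Prop. 10] -/
theorem frobPow_eq_frobPow_mod (m i : ℕ) :
    ((absoluteGaloisGroup.toAlgEquiv F σ₀).restrictNormal (E m)) ^ i =
      ((absoluteGaloisGroup.toAlgEquiv F σ₀).restrictNormal (E m)) ^ (i % p ^ m) := by
  rw [← hdeg m, ← orderOf_restrictNormal_eq_finrank (E m) (hE m) hσ₀, pow_mod_orderOf]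

include hE hdeg hσ₀ in
/-- **Compatibility with the projections**: `(φ_{m+1}^{y})|_{E_m} = φ_m^{y mod p^m}`. [cite: deShalit1987, Ch. I §3.1] -/
theorem towerRestrict_frobPow (m : ℕ) (y : ZMod (p ^ (m + 1))) :
    towerRestrict (hmono (Nat.le_succ m)) (((absoluteGaloisGroup.toAlgEquiv F σ₀).restrictNormal (E (m + 1))) ^ y.val) =
      ((absoluteGaloisGroup.toAlgEquiv F σ₀).restrictNormal (E m)) ^ (ZMod.castHom (pow_dvd_pow p m.le_succ) (ZMod (p ^ m)) y).val := by
  haveI : NeZero (p ^ (m + 1)) := ⟨pow_ne_zero _ hp.out.ne_zero⟩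
  rw [map_pow, towerRestrict_restrictNormal, ZMod.castHom_apply, ZMod.cast_eq_val, ZMod.val_natCast]
  exact frobPow_eq_frobPow_mod p E hE hdeg hσ₀ m y.val

include hE hdeg hσ₀ in
/-- **`x ↦ φ_m^x` is a bijection `ℤ/p^mℤ → Gal(E_m/F)`** (`Gal(E_m/F) = ⟨φ_m⟩` of order `[E_m:F] = p^m`). [cite: SerreLocalFields1979, Ch. I §4 Prop. 10] -/
theorem frobPow_bijective (m : ℕ) :
    Function.Bijective fun x : ZMod (p ^ m) => ((absoluteGaloisGroup.toAlgEquiv F σ₀).restrictNormal (E m)) ^ x.val := by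
  haveI : NeZero (p ^ m) := ⟨pow_ne_zero _ hp.out.ne_zero⟩
  have hb := bijective_restrictNormal_pow (E m) (hE m) hσ₀
  -- `x ↦ ⟨x.val, _⟩ : ZMod (p^m) → Fin [E_m:F]` is a bijection
  have hv : Function.Bijective fun x : ZMod (p ^ m) => (⟨x.val, (hdeg m).symm ▸ ZMod.val_lt x⟩ : Fin (Module.finrank F (E m))) := by
    refine ⟨fun x y hxy => ZMod.val_injective _ (by simpa using hxy), fun i => ⟨(i.val : ZMod (p ^ m)), Fin.ext ?_⟩⟩
    simp only [ZMod.val_natCast]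
    exact Nat.mod_eq_of_lt ((hdeg m) ▸ i.2)
  exact hb.comp hv

include hE hdeg hσ₀ in
/-- **Transport of push-forward-coherence** along `x ↦ φ_m^x`: for functions `a_m` on `Gal(E_m/F)` and `a_{m+1}` on `Gal(E_{m+1}/F)`,
`a_m(ρ) = Σ_{σ|_{E_m} = ρ} a_{m+1}(σ)` for all `ρ` iff `a_m(φ_m^x) = Σ_{y ↦ x} a_{m+1}(φ_{m+1}^y)` for all `x ∈ ℤ/p^mℤ`.
[cite: deShalit1987, Ch. I §3.1] -/
theorem pushforward_frobPow_iff (m : ℕ) (a₁ : (E m ≃ₐ[F] E m) → 𝒪[F]) (a₂ : (E (m + 1) ≃ₐ[F] E (m + 1)) → 𝒪[F]) :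
    open scoped Classical in
    (∀ ρ : E m ≃ₐ[F] E m, a₁ ρ = ∑ σ ∈ univ.filter (fun σ : E (m + 1) ≃ₐ[F] E (m + 1) => towerRestrict (hmono (Nat.le_succ m)) σ = ρ), a₂ σ) ↔
      ∀ x : ZMod (p ^ m), a₁ (((absoluteGaloisGroup.toAlgEquiv F σ₀).restrictNormal (E m)) ^ x.val) =
        ∑ y ∈ univ.filter (fun y : ZMod (p ^ (m + 1)) => ZMod.castHom (pow_dvd_pow p m.le_succ) (ZMod (p ^ m)) y = x),
          a₂ (((absoluteGaloisGroup.toAlgEquiv F σ₀).restrictNormal (E (m + 1))) ^ y.val) := by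
  classical
  have hb₁ := frobPow_bijective p E hE hdeg hσ₀ m
  have hb₂ := frobPow_bijective p E hE hdeg hσ₀ (m + 1)
  -- the fibre sums correspond under `y ↦ φ_{m+1}^y`
  have hfib : ∀ x : ZMod (p ^ m),
      ∑ σ ∈ univ.filter (fun σ : E (m + 1) ≃ₐ[F] E (m + 1) =>
        towerRestrict (hmono (Nat.le_succ m)) σ = ((absoluteGaloisGroup.toAlgEquiv F σ₀).restrictNormal (E m)) ^ x.val), a₂ σ =
      ∑ y ∈ univ.filter (fun y : ZMod (p ^ (m + 1)) => ZMod.castHom (pow_dvd_pow p m.le_succ) (ZMod (p ^ m)) y = x),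
        a₂ (((absoluteGaloisGroup.toAlgEquiv F σ₀).restrictNormal (E (m + 1))) ^ y.val) := by
    intro x
    symm
    refine sum_bij (fun y _ => ((absoluteGaloisGroup.toAlgEquiv F σ₀).restrictNormal (E (m + 1))) ^ y.val) (fun y hy => ?_)
      (fun y₁ _ y₂ _ h => hb₂.1 h) (fun σ hσ => ?_) (fun y _ => rfl)
    · rw [mem_filter] at hy ⊢
      refine ⟨mem_univ _, ?_⟩
      rw [towerRestrict_frobPow p E hmono hE hdeg hσ₀, hy.2]
    · rw [mem_filter] at hσ
      obtain ⟨y, rfl⟩ := hb₂.2 σ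
      refine ⟨y, ?_, rfl⟩
      rw [mem_filter]
      refine ⟨mem_univ _, hb₁.1 ?_⟩
      simp only
      rw [← towerRestrict_frobPow p E hmono hE hdeg hσ₀]
      exact hσ.2
  constructor
  · intro h x
    rw [h, hfib]
  · intro h ρ
    obtain ⟨x, rfl⟩ := hb₁.2 ρ
    rw [hfib]
    exact h x

/-! ### `lim←_{Tr} 𝒪_{E_m} ≅ 𝒪_F⟦X⟧` -/

include hE hdeg hσ₀ in
/-- ★★★ **The Iwasawa–Amice transform of a trace-coherent family**: for trace-coherent normal integral generators `θ` and a family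
`x = (x_m ∈ 𝒪_{E_m})` with `Tr x_{m+1} = x_m`, there is a UNIQUE `g ∈ 𝒪_F⟦X⟧` with
`g ≡ Σ_{i ∈ ℤ/p^m} a_{x_m}(φ_m^i)·(1+X)^i (mod (1+X)^{p^m} − 1)` for all `m` (`a_{x_m}` the coordinates of `x_m` in the basis `(σθ_m)_σ`).
[cite: deShalit1987, Ch. I §3.1, §3.8 (17)] -/
theorem existsUnique_amice_of_traceCoherent [IsAdicComplete (Ideal.span {(p : 𝒪[F])}) 𝒪[F]] {θ : ∀ m, unitBall (E m)} (hθ : ∀ m, IsIntegralNormalGen (E m) (θ m))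
    (hcoh : ∀ m, unitBallTrace (hmono (Nat.le_succ m)) (θ (m + 1)) = θ m) (x : ∀ m, unitBall (E m))
    (hx : ∀ m, unitBallTrace (hmono (Nat.le_succ m)) (x (m + 1)) = x m) :
    ∃! g : PowerSeries 𝒪[F], ∀ m, ((1 + PowerSeries.X : PowerSeries 𝒪[F]) ^ p ^ m - 1) ∣
      g - ∑ i : ZMod (p ^ m), PowerSeries.C ((hθ m).basis.repr (x m) (((absoluteGaloisGroup.toAlgEquiv F σ₀).restrictNormal (E m)) ^ i.val)) *
        (1 + PowerSeries.X) ^ i.val := by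
  classical
  refine existsUnique_forall_omega_dvd_sub_amice p
    (fun m (i : ZMod (p ^ m)) => (hθ m).basis.repr (x m) (((absoluteGaloisGroup.toAlgEquiv F σ₀).restrictNormal (E m)) ^ i.val)) fun m => ?_
  exact (pushforward_frobPow_iff p E hmono hE hdeg hσ₀ m _ _).mp
    (fun ρ => (traceCoherent_iff_pushforward E hmono hθ hcoh x).mp hx m ρ)

include hE hdeg hσ₀ in
/-- ★★★ **Conversely every `g ∈ 𝒪_F⟦X⟧` is the transform of a UNIQUE trace-coherent family** (`p` not a unit of `𝒪_F`): with
`existsUnique_amice_of_traceCoherent` this is the bijection `lim←_{Tr} 𝒪_{E_m} ≅ 𝒪_F⟦X⟧`. [cite: deShalit1987, Ch. I §3.1, §3.8 (17)] -/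
theorem existsUnique_traceCoherent_of_series [IsAdicComplete (Ideal.span {(p : 𝒪[F])}) 𝒪[F]] (hI : Ideal.span {(p : 𝒪[F])} ≠ ⊤) {θ : ∀ m, unitBall (E m)}
    (hθ : ∀ m, IsIntegralNormalGen (E m) (θ m)) (hcoh : ∀ m, unitBallTrace (hmono (Nat.le_succ m)) (θ (m + 1)) = θ m)
    (g : PowerSeries 𝒪[F]) :
    ∃! x : ∀ m, unitBall (E m), (∀ m, unitBallTrace (hmono (Nat.le_succ m)) (x (m + 1)) = x m) ∧
      ∀ m, ((1 + PowerSeries.X : PowerSeries 𝒪[F]) ^ p ^ m - 1) ∣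
        g - ∑ i : ZMod (p ^ m), PowerSeries.C ((hθ m).basis.repr (x m) (((absoluteGaloisGroup.toAlgEquiv F σ₀).restrictNormal (E m)) ^ i.val)) *
          (1 + PowerSeries.X) ^ i.val := by
  classical
  -- the compatible family of functions on the `ℤ/p^m`
  obtain ⟨b, ⟨hb, hbg⟩, hbuniq⟩ := existsUnique_compatible_amice p hI g
  -- transport to functions on the Galois groups through the bijections `i ↦ φ_m^i`
  have hbij := fun m => frobPow_bijective p E hE hdeg hσ₀ m
  obtain ⟨a, ha⟩ : ∃ a : ∀ m, (E m ≃ₐ[F] E m) → 𝒪[F],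
      ∀ m (i : ZMod (p ^ m)), a m (((absoluteGaloisGroup.toAlgEquiv F σ₀).restrictNormal (E m)) ^ i.val) = b m i := by
    refine ⟨fun m ρ => b m (Function.surjInv (hbij m).2 ρ), fun m i => ?_⟩
    exact congrArg (b m) ((hbij m).1 (Function.surjInv_eq (hbij m).2 _))
  have hapush : ∀ m (ρ : E m ≃ₐ[F] E m), a m ρ = ∑ σ ∈ univ.filter
      (fun σ : E (m + 1) ≃ₐ[F] E (m + 1) => towerRestrict (hmono (Nat.le_succ m)) σ = ρ), a (m + 1) σ := by
    intro m
    refine (pushforward_frobPow_iff p E hmono hE hdeg hσ₀ m (a m) (a (m + 1))).mpr fun i => ?_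
    rw [ha, hb m i]
    exact sum_congr rfl fun y _ => by rw [ha]
  -- the trace-coherent family with these coordinates
  obtain ⟨x, ⟨hx, hxa⟩, hxuniq⟩ := exists_unique_traceCoherent_of_pushforward E hmono hθ hcoh a hapush
  refine ⟨x, ⟨hx, fun m => ?_⟩, ?_⟩
  · have e : (∑ i : ZMod (p ^ m), PowerSeries.C ((hθ m).basis.repr (x m)
        (((absoluteGaloisGroup.toAlgEquiv F σ₀).restrictNormal (E m)) ^ i.val)) * (1 + PowerSeries.X) ^ i.val) =
        ∑ i : ZMod (p ^ m), PowerSeries.C (b m i) * (1 + PowerSeries.X) ^ i.val :=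
      sum_congr rfl fun i _ => by rw [hxa, ha]
    rw [e]
    exact hbg m
  · rintro x' ⟨hx', hx'g⟩
    -- the coordinate functions of `x'` on the `ℤ/p^m` form a compatible family with transform `g`, hence equal `b`
    have hb' : (fun m (i : ZMod (p ^ m)) => (hθ m).basis.repr (x' m) (((absoluteGaloisGroup.toAlgEquiv F σ₀).restrictNormal (E m)) ^ i.val)) = b := by
      refine hbuniq _ ⟨fun m i => ?_, hx'g⟩
      exact (pushforward_frobPow_iff p E hmono hE hdeg hσ₀ m _ _).mp
        (fun ρ => (traceCoherent_iff_pushforward E hmono hθ hcoh x').mp hx' m ρ) i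
    refine hxuniq x' ⟨hx', fun m ρ => ?_⟩
    obtain ⟨i, rfl⟩ := (hbij m).2 ρ
    rw [ha, ← hb']

/-! ### The Frobenius is multiplication by `1 + X` -/

omit hp [TopologicalSpace F] [IsNonarchimedeanLocalField F] in
/-- `(1+X)·Σ_y b(y)(1+X)^y ≡ Σ_y b(y − 1)(1+X)^y (mod ω_m)` on `ℤ/p^mℤ` (reindex `y ↦ y + 1`; `(1+X)^{p^m} ≡ 1`).
[cite: Washington1997, §7.1 Theorem 7.1] -/
theorem omega_dvd_one_add_X_mul_amice_sub (m : ℕ) [NeZero (p ^ m)] (b : ZMod (p ^ m) → 𝒪[F]) :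
    ((1 + PowerSeries.X : PowerSeries 𝒪[F]) ^ p ^ m - 1) ∣
      (1 + PowerSeries.X) * (∑ y : ZMod (p ^ m), PowerSeries.C (b y) * (1 + PowerSeries.X) ^ y.val) -
        ∑ y : ZMod (p ^ m), PowerSeries.C (b (y - 1)) * (1 + PowerSeries.X) ^ y.val := by
  -- reindex the second sum by `y ↦ y + 1`
  have e : (∑ y : ZMod (p ^ m), PowerSeries.C (b (y - 1)) * (1 + PowerSeries.X) ^ y.val) =
      ∑ y : ZMod (p ^ m), PowerSeries.C (b y) * (1 + PowerSeries.X) ^ (y + 1).val :=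
    Fintype.sum_equiv (Equiv.subRight (1 : ZMod (p ^ m))) _ _ fun y => by
      simp only [Equiv.subRight_apply, sub_add_cancel]
  rw [e, mul_sum, ← sum_sub_distrib]
  refine dvd_sum fun y _ => ?_
  have e2 : (1 + PowerSeries.X : PowerSeries 𝒪[F]) * (PowerSeries.C (b y) * (1 + PowerSeries.X) ^ y.val) -
      PowerSeries.C (b y) * (1 + PowerSeries.X) ^ (y + 1).val =
      PowerSeries.C (b y) * ((1 + PowerSeries.X) ^ (y.val + 1) - (1 + PowerSeries.X) ^ ((y.val + 1) % p ^ m)) := by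
    have hv : (y + 1).val = (y.val + 1) % p ^ m := by
      rw [ZMod.val_add, ZMod.val_one_eq_one_mod, Nat.add_mod_mod]
    rw [hv, pow_succ, mul_sub]; ring
  rw [e2]
  exact Dvd.dvd.mul_left (omega_dvd_one_add_X_pow_sub p m (y.val + 1)) _

include hE hdeg hσ₀ in
/-- In the coordinates on `ℤ/p^mℤ` the Frobenius is the shift `i ↦ i − 1`: `a_{φ_m x}(φ_m^i) = a_x(φ_m^{i−1})`.
[cite: deShalit1987, Ch. I §3.1] -/
theorem repr_frob_frobPow {m : ℕ} {θ : unitBall (E m)} (hθ : IsIntegralNormalGen (E m) θ) (x : unitBall (E m)) (i : ZMod (p ^ m)) :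
    hθ.basis.repr (unitBallEquiv (E m) ((absoluteGaloisGroup.toAlgEquiv F σ₀).restrictNormal (E m)) x)
        (((absoluteGaloisGroup.toAlgEquiv F σ₀).restrictNormal (E m)) ^ i.val) =
      hθ.basis.repr x (((absoluteGaloisGroup.toAlgEquiv F σ₀).restrictNormal (E m)) ^ (i - 1).val) := by
  haveI : NeZero (p ^ m) := ⟨pow_ne_zero _ hp.out.ne_zero⟩
  rw [hθ.repr_unitBallEquiv]
  congr 1
  -- `φ⁻¹ φ^{i} = φ^{(i-1)}`: both have the same product with `φ`
  have h1 : ((absoluteGaloisGroup.toAlgEquiv F σ₀).restrictNormal (E m)) ^ (i - 1).val *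
      ((absoluteGaloisGroup.toAlgEquiv F σ₀).restrictNormal (E m)) =
      ((absoluteGaloisGroup.toAlgEquiv F σ₀).restrictNormal (E m)) ^ i.val := by
    rw [← pow_succ, frobPow_eq_frobPow_mod p E hE hdeg hσ₀ m ((i - 1).val + 1)]
    congr 1
    have h2 : ((i - 1) + 1 : ZMod (p ^ m)).val = ((i - 1).val + 1) % p ^ m := by
      rw [ZMod.val_add, ZMod.val_one_eq_one_mod, Nat.add_mod_mod]
    rw [← h2, sub_add_cancel]
  rw [← h1, (Commute.pow_self _ _).eq, inv_mul_cancel_left]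

include hE hdeg hσ₀ in
/-- ★★ **The Frobenius is multiplication by `1 + X`**: if `g` is the transform of the trace-coherent family `x`, then `(1 + X)·g` is the
transform of `(φ_m x_m)_m` — so under `lim←_{Tr} 𝒪_{E_m} ≅ 𝒪_F⟦X⟧` the generator `φ` of `Gal(E_∞/F)` acts as `1 + X`, i.e. `lim←_{Tr} 𝒪_{E_m}`
is free of rank one over `Λ = 𝒪_F⟦X⟧`, `X = φ − 1`. [cite: deShalit1987, Ch. I §3.1 ("maps `u^α` to `(1+S)^α`")] -/
theorem amice_frob {θ : ∀ m, unitBall (E m)} (hθ : ∀ m, IsIntegralNormalGen (E m) (θ m)) (x : ∀ m, unitBall (E m))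
    (g : PowerSeries 𝒪[F])
    (hg : ∀ m, ((1 + PowerSeries.X : PowerSeries 𝒪[F]) ^ p ^ m - 1) ∣
      g - ∑ i : ZMod (p ^ m), PowerSeries.C ((hθ m).basis.repr (x m) (((absoluteGaloisGroup.toAlgEquiv F σ₀).restrictNormal (E m)) ^ i.val)) *
        (1 + PowerSeries.X) ^ i.val) (m : ℕ) :
    ((1 + PowerSeries.X : PowerSeries 𝒪[F]) ^ p ^ m - 1) ∣
      (1 + PowerSeries.X) * g - ∑ i : ZMod (p ^ m), PowerSeries.C ((hθ m).basis.repr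
        (unitBallEquiv (E m) ((absoluteGaloisGroup.toAlgEquiv F σ₀).restrictNormal (E m)) (x m))
          (((absoluteGaloisGroup.toAlgEquiv F σ₀).restrictNormal (E m)) ^ i.val)) * (1 + PowerSeries.X) ^ i.val := by
  haveI : NeZero (p ^ m) := ⟨pow_ne_zero _ hp.out.ne_zero⟩
  have e : (∑ i : ZMod (p ^ m), PowerSeries.C ((hθ m).basis.repr
      (unitBallEquiv (E m) ((absoluteGaloisGroup.toAlgEquiv F σ₀).restrictNormal (E m)) (x m))
        (((absoluteGaloisGroup.toAlgEquiv F σ₀).restrictNormal (E m)) ^ i.val)) * (1 + PowerSeries.X) ^ i.val) =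
      ∑ i : ZMod (p ^ m), PowerSeries.C ((hθ m).basis.repr (x m)
        (((absoluteGaloisGroup.toAlgEquiv F σ₀).restrictNormal (E m)) ^ (i - 1).val)) * (1 + PowerSeries.X) ^ i.val :=
    sum_congr rfl fun i _ => by rw [repr_frob_frobPow p E hE hdeg hσ₀]
  rw [e]
  have h1 := (hg m).mul_left (1 + PowerSeries.X : PowerSeries 𝒪[F])
  rw [mul_sub] at h1
  have h2 := omega_dvd_one_add_X_mul_amice_sub p m fun i : ZMod (p ^ m) =>
    (hθ m).basis.repr (x m) (((absoluteGaloisGroup.toAlgEquiv F σ₀).restrictNormal (E m)) ^ i.val)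
  have h3 := dvd_add h1 h2
  rwa [sub_add_sub_cancel] at h3

end UnramifiedTowerIwasawa

end Literature.NumberTheory.GaloisRepresentations
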